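import Summits.QuantumFields.YangMills.Theses.BalabanLadder
import Summits.QuantumFields.YangMills.Theorems.BalabanLadderUVRecord13SepCoP

/-!
# BalabanLadder ∕ UV — the v1.5 (`Provisos₁₃SepCoP`) Record-13 station AT THE SPINE LEAF BY NAME: `UVAtParams13SepCoP 2 → BalabanLadder.UV`,
# `UVAtRecord13CSepCoP 2 → BalabanLadder.UV`, and Track A's rev-20 four item TEXTS ⟹ `BalabanLadder.UV` by name

OS-ASSEMBLY BOOKKEEPING (cell `ym-fleet`, seat `ym-osasm-p1`, director-ym R136 (iii); `--supports stmt-QuantumFields-19351`).  Three one-line theorems;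
0 `sorry`, 0 `def`, standard axioms; COUNT-NEUTRAL.  The `Provisos₁₃SepCoP` twin of `Theorems/BalabanLadderUVRecord13SepTether.lean` (p503301).  This is the
ONLY module of the v1.5 Record-13 station that imports the spine route file `Summits.QuantumFields.YangMills.Theses.BalabanLadder` (a LEAF: nothing
imports it); it does NOT import Track A's route file — the four rev-20 item texts enter through `uvAtParams13SepCoP_of_chain`'s INLINE binders, which those
items feed by unfolding.  Sensitive only to the TEXT of `BalabanLadder.UV` (owner RULING R27: Stage-0 form kept through R85).

* `uv_of_uvAtParams13SepCoP_two` — the θ-keyed v1.5 package at `N = 2` gives the spine leaf BY NAME (`stage0_of_uvAtParams13SepCoP`, definitional unfolding).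
* `uv_of_uvAtRecord13CSepCoP_two` — the same from the (D, w)-keyed package (`stage0_of_uvAtRecord13CSepCoP`).
* `uv_of_record13SepCoPChain_two` — Track A's rev-20 four TEXTS at `N = 2` ⟹ `BalabanLadder.UV` BY NAME; as TERMS it is the re-keyed
  `BalabanUVNodes.closes` (the D-0061 identity junction `= @BalabanUVNodes.closes := rfl`, desk scratch attached as evidence on stmt-QuantumFields-19351
  after the route's rev-20 edit).

HONEST FRAMING.  Modus-ponens glue for HYPOTHESES of a conditional chain (Track A's four ⁵ items are OPEN; 0∕6 spine legs discharged); one finite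
four-torus programme per family at fixed ε; NOT infinite volume, NOT OS on ℝ⁴, NOT a mass gap, NOT Clay.
-/

set_option autoImplicit false

namespace Summit.QuantumFields.YangMills.Cruxes.UV.Record13SepCoP

open Literature.MathematicalPhysics.QuantumFieldTheory.Balaban1983to89
open Literature.MathematicalPhysics.QuantumFieldTheory.Balaban1983to89.T4Continuum

/-- **THE θ-KEYED STAGE-13 PACKAGE AT `N = 2` GIVES THE SPINE LEAF BY NAME**: `UVAtParams13SepCoP 2 → Summit.QuantumFields.YangMills.Theses.BalabanLadder.UV`
(the Stage-0 projection `stage0_of_uvAtParams13SepCoP`; `UV`'s text of record IS that Stage-0 conjunction, owner RULING R27). -/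
theorem uv_of_uvAtParams13SepCoP_two (h : UVAtParams13SepCoP 2) : Summit.QuantumFields.YangMills.Theses.BalabanLadder.UV :=
  fun F => stage0_of_uvAtParams13SepCoP h F

/-- **THE (D, w)-KEYED STAGE-13 PACKAGE AT `N = 2` GIVES THE SPINE LEAF BY NAME** (`stage0_of_uvAtRecord13CSepCoP`). -/
theorem uv_of_uvAtRecord13CSepCoP_two (h : UVAtRecord13CSepCoP 2) : Summit.QuantumFields.YangMills.Theses.BalabanLadder.UV :=
  fun F => stage0_of_uvAtRecord13CSepCoP h F

/-- **TRACK A's REV-20 FOUR ITEM TEXTS AT `N = 2` ⟹ THE SPINE LEAF BY NAME**: inhabitation of the admissible Stage-13 unity tuples with non-degenerate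
slots (text of K0⁵ `Record13SepCoPInhabited`) · (B) + window at some such tuple (K1⁵ `StabilityBAtRecordR13SepCoP`) · END given (B) + window (K2⁵
`EndpointGivenBR13SepCoP`) · hybrid-NE7 spine given (B) + END (K3⁵ `SpineGivenEndpointR13SepCoP`) ⟹ `BalabanLadder.UV` — through the station (`uvAtParams13SepCoP_of_chain`, then the
projection).  The items feed these binders by unfolding; as terms this is the rev-20 `BalabanUVNodes.closes`. -/
theorem uv_of_record13SepCoPChain_two
    (h0 : ∀ F : T4Family, ∃ θ : Node00.Stage13Params F 2, θ.Provisos₁₃SepCoP F 2 ∧ (θ.ZtUnity F 2 ∧ θ.SlotsNondegenerate₁₃ F 2) ∧ θ.Admissible F 2)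
    (h1 : ∀ F : T4Family, (∃ θ : Node00.Stage13Params F 2, θ.Provisos₁₃SepCoP F 2 ∧ (θ.ZtUnity F 2 ∧ θ.SlotsNondegenerate₁₃ F 2) ∧ θ.Admissible F 2) →
      ∃ (θ : Node00.Stage13Params F 2) (h : θ.Provisos₁₃SepCoP F 2), (θ.ZtUnity F 2 ∧ θ.SlotsNondegenerate₁₃ F 2) ∧ θ.Admissible F 2 ∧
        B16.EndStatementBPrinted (Node00.datumOfRecord₁₃SepCoP F 2 θ h).C ∧ ∃ γ₁ : ℝ, 0 < γ₁ ∧ ∀ γ : ℝ, 0 < γ → γ ≤ γ₁ →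
          ∃ P : B12.RunParams, 1 ≤ P.K ∧ ((Node00.datumOfRecord₁₃SepCoP F 2 θ h).C P).flow.InInterval γ P.K)
    (h2 : ∀ (F : T4Family) (θ : Node00.Stage13Params F 2) (h : θ.Provisos₁₃SepCoP F 2), (θ.ZtUnity F 2 ∧ θ.SlotsNondegenerate₁₃ F 2) → θ.Admissible F 2 →
      B16.EndStatementBPrinted (Node00.datumOfRecord₁₃SepCoP F 2 θ h).C → (∃ γ₁ : ℝ, 0 < γ₁ ∧ ∀ γ : ℝ, 0 < γ → γ ≤ γ₁ →
        ∃ P : B12.RunParams, 1 ≤ P.K ∧ ((Node00.datumOfRecord₁₃SepCoP F 2 θ h).C P).flow.InInterval γ P.K) →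
      DagBinding.EndpointExistence (Node00.datumOfRecord₁₃SepCoP F 2 θ h).C.toB12)
    (h3 : ∀ (F : T4Family) (θ : Node00.Stage13Params F 2) (h : θ.Provisos₁₃SepCoP F 2), (θ.ZtUnity F 2 ∧ θ.SlotsNondegenerate₁₃ F 2) → θ.Admissible F 2 →
      B16.EndStatementBPrinted (Node00.datumOfRecord₁₃SepCoP F 2 θ h).C → DagBinding.EndpointExistence (Node00.datumOfRecord₁₃SepCoP F 2 θ h).C.toB12 →
      T4ApexHybrid.HybridNE7Under (Node00.datumOfRecord₁₃SepCoP F 2 θ h) (DagBinding.EndpointExistence (Node00.datumOfRecord₁₃SepCoP F 2 θ h).C.toB12)) :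
    Summit.QuantumFields.YangMills.Theses.BalabanLadder.UV :=
  uv_of_uvAtParams13SepCoP_two (uvAtParams13SepCoP_of_chain h0 h1 h2 h3)

end Summit.QuantumFields.YangMills.Cruxes.UV.Record13SepCoP
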